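import Mathlib
import Literature.NumberTheory.Transcendental.ExpOneTranscendenceMeasureProofs
import Literature.Barriers.Schanuel.LargeTranscendenceDegreeHolds
import Literature.Barriers.Schanuel.LargeTranscendenceDegreeProofs
import Literature.NumberTheory.Transcendental.DiazGrid
import Summits.Schanuel.Schanuel.Theorems.RigidCoreSchanuelOnLogFreeCorePiPowersTH
import Summits.Schanuel.Schanuel.Theorems.RigidCoreSchanuelOnLogFreeCoreDiazAnyBase
import Summits.Schanuel.Schanuel.Theorems.RigidCoreSchanuelOnLogFreeCoreCalibrationR

/-!
# The Technical Hypothesis for the powers of `e` and Diaz's Theorem 2.7 on the `e`-power grid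
# (stubs `stub_expOnePowersTH`, `stub_expOneGridBound` of line `sector-split`)

Registered calibration stubs C12 `stub_expOnePowersTH` and C13 `stub_expOneGridBound` of line
`sector-split` (skeleton v21, lead c11) of crux `stmt-Schanuel-0970`
(`Summit.Schanuel.Schanuel.Theses.RigidCore.SchanuelOnLogFreeCore`, (R): Schanuel's conjecture for
`ℚ`-linearly independent tuples of the log-free core
`C_EA = sInf {K ≤ ℂ | 2πi ∈ K, K exp-closed, K relatively algebraically closed}`).

This is a CALIBRATION of (R), off the path to the crux (whose residues are the open items
stmt-Schanuel-9545 / 9548): the `e`-analogue of lead c2's kernel Hankel bound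
(`RigidCoreSchanuelOnLogFreeCorePiPowersTH.lean`, p107393, for `2πi`).  Write `e = exp 1 ∈ C_EA`.

* `ExpOnePowersTH.norm_aeval_exp_one_lowerBound` — a **polynomial lower bound for integer linear
  forms in the powers of `e`**: for every `d` there are `c > 0` and `k` with
  `c ≤ (∑ᵢ |hᵢ|)^k · |∑_{i<d} hᵢ eⁱ|` for all non-zero `h ∈ ℤ^d`.  Source: the transcendence measure
  of `e` of Yu. V. Nesterenko and M. Waldschmidt (1996), Theorem 4 (2):
  `|P(e)| ≥ exp(−1.3·10⁵ d² (log L + d))` for `P ∈ ℤ[X] ∖ 0`, `deg P ≤ d`, `L(P) ≤ L`, `L ≥ 3` —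
  PROVED in the tree (`Literature.NumberTheory.Transcendental.NW1996.transcendence_measure_exp_one`,
  discharging the named fact `NesterenkoWaldschmidt1996_thm_4_2`).  With `L = 3 ∑|hᵢ|` the bound is
  `exp(−c₀(log 3 + d)) · (∑|hᵢ|)^{−c₀}`, `c₀ = 1.3·10⁵ d²`, polynomial in `∑|hᵢ|`.
* `stub_expOnePowersTH` (registered signature verbatim) — the **Technical Hypothesis**
  (Yu. V. Nesterenko, P. Philippon (eds.), LNM 1752, Ch. 14, Def. 2.6) for `(1, e, …, e^{d−1})`, by
  the tree's `TechnicalHypothesis.of_lowerBound` (a polynomial lower bound implies (T.H.)).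
* `stub_expOneGridBound` (registered signature verbatim) — **Diaz's Theorem 2.7, clause `t₂`**
  (LNM 1752, Ch. 14, Thm 2.7; Philippon 1986; PROVED in the tree as
  `Literature.Barriers.Schanuel.ceil_le_trdeg_gridField₂`) made UNCONDITIONAL on the grid
  `x = (eⁱ)_{i<d}`, `y = (eʲ)_{j<ℓ}`: for `d + ℓ < dℓ`,
  `⌈dℓ/(d+ℓ)⌉ ≤ trdeg_ℚ ℚ(e^{e^k} : k ≤ d + ℓ − 2)` — the field `ℚ(e, e^e, e^{e²}, …, e^{e^{d+ℓ−2}})`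
  (`e = e^{e⁰}`).  Instances: `(4, 5)`: three of `e, e^e, …, e^{e⁷}` are algebraically independent;
  `(6, 7)`: four of `e, e^e, …, e^{e^{11}}`.  Schanuel's conjecture — indeed (R), since
  `(1, e, …, e^{N−1})` is a `ℚ`-free core tuple — predicts `N` for the `N`-tuple; the grid gives
  `≈ (N+1)/4` (`N = d + ℓ − 1`).

Auxiliaries live in the sub-namespace `…RigidCore.ExpOnePowersTH`; only the two registered stubs are
declared directly in `Summit.Schanuel.Schanuel.Theorems.RigidCore`.  No definitions, no hypotheses of
`Prop`-valued definitions; the bookkeeping lemmas on `P_h = ∑ hᵢ Xⁱ` are lead c2's `KernelTower.*`.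

## References

* Yu. V. Nesterenko, M. Waldschmidt, *On the approximation of the values of exponential function and
  logarithm by algebraic numbers*, Mat. Zapiski 2 (1996), 23–42 (arXiv:math/0002047), Theorem 4 (2).
  [NesterenkoWaldschmidt1996]
* Yu. V. Nesterenko, P. Philippon (eds.), *Introduction to Algebraic Independence Theory*, LNM 1752,
  Springer (2001), Ch. 14, Definition 2.6 and Theorem 2.7. [NesterenkoPhilippon2001]
-/

noncomputable section

namespace Summit.Schanuel.Schanuel.Theorems.RigidCore

open Polynomial

namespace ExpOnePowersTH

/-! ### The length of `P_h = ∑ hᵢ Xⁱ` -/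

/-- The length of `P_h = ∑_{j<d} h_j X^j` over any finite set of indices is at most `∑ |h_j|`
(each coefficient of `P_h` is one of the `h_j` or `0`, and distinct indices pick distinct `j`).
[folklore] -/
theorem sum_abs_coeff_sum_monomial_le {d : ℕ} (h : Fin d → ℤ) (s : Finset ℕ) :
    ∑ k ∈ s, |(∑ j : Fin d, monomial (j : ℕ) (h j)).coeff k| ≤ ∑ j, |h j| := by
  calc ∑ k ∈ s, |(∑ j : Fin d, monomial (j : ℕ) (h j)).coeff k|
      ≤ ∑ k ∈ s, ∑ j : Fin d, (if (j : ℕ) = k then |h j| else 0) := by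
        refine Finset.sum_le_sum fun k _ => ?_
        rw [finsetSum_coeff]
        refine (Finset.abs_sum_le_sum_abs _ _).trans (le_of_eq ?_)
        refine Finset.sum_congr rfl fun j _ => ?_
        rw [coeff_monomial]
        split_ifs <;> simp
    _ = ∑ j : Fin d, ∑ k ∈ s, (if (j : ℕ) = k then |h j| else 0) := Finset.sum_comm
    _ ≤ ∑ j, |h j| := by
        refine Finset.sum_le_sum fun j _ => ?_
        rw [Finset.sum_ite_eq]
        split_ifs
        · exact le_rfl
        · exact abs_nonneg _

/-! ### The transcendence measure of `e` as a polynomial lower bound -/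

/-- **Polynomial lower bound for integer linear forms in `1, e, …, e^{d−1}`**, the input of
`TechnicalHypothesis.of_lowerBound`: for every `d` there are `c > 0` and `k ∈ ℕ` with
`c ≤ (∑ᵢ |hᵢ|)^k · |∑_{i<d} hᵢ eⁱ|` for every non-zero `h ∈ ℤ^d`.  Proof: `P_h = ∑ hᵢ Xⁱ ≠ 0` has
degree `≤ d` and length `≤ H = ∑|hᵢ|`, so the Nesterenko–Waldschmidt measure with `L = 3H ≥ 3` gives
`|P_h(e)| ≥ exp(−c₀(log 3 + log H + d)) = exp(−c₀(log 3 + d)) · H^{−c₀}` with `c₀ = 1.3·10⁵ d²`;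
take `k = ⌈c₀⌉` and `c = exp(−c₀(log 3 + d))` (`H^k · H^{−c₀} ≥ 1` as `H ≥ 1`).
[cite: NesterenkoWaldschmidt1996, Thm 4(2)] -/
theorem norm_aeval_exp_one_lowerBound (d : ℕ) :
    ∃ c : ℝ, 0 < c ∧ ∃ k : ℕ, ∀ h : Fin d → ℤ, h ≠ 0 →
      c ≤ (∑ i, |(h i : ℝ)|) ^ k * ‖∑ i, (h i : ℂ) * (Complex.exp 1) ^ (i : ℕ)‖ := by
  rcases Nat.eq_zero_or_pos d with rfl | hd
  · exact ⟨1, one_pos, 0, fun h hh => (hh (Subsingleton.elim _ _)).elim⟩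
  obtain ⟨c₀, hc₀⟩ : ∃ c₀ : ℝ, c₀ = 1.3 * 10 ^ 5 * (d : ℝ) ^ 2 := ⟨_, rfl⟩
  have hc₀0 : 0 ≤ c₀ := by rw [hc₀]; positivity
  refine ⟨Real.exp (-(c₀ * (Real.log 3 + d))), Real.exp_pos _, ⌈c₀⌉₊, fun h hh => ?_⟩
  set K : ℕ := ⌈c₀⌉₊ with hK
  set P : ℤ[X] := ∑ j : Fin d, monomial (j : ℕ) (h j) with hP
  set H : ℕ := ∑ i, (h i).natAbs with hH
  have hP0 : P ≠ 0 := KernelTower.sum_monomial_ne_zero hh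
  -- the height `H = ∑ |hᵢ| ≥ 1`
  have hHZ : (H : ℤ) = ∑ i, |h i| := by
    rw [hH]; push_cast [Int.natCast_natAbs]; rfl
  have hHR : (H : ℝ) = ∑ i, |(h i : ℝ)| := by
    have : ((H : ℤ) : ℝ) = ((∑ i, |h i| : ℤ) : ℝ) := by rw [hHZ]
    push_cast at this
    exact this
  have hH1 : 1 ≤ H := by
    obtain ⟨i, hi⟩ : ∃ i, h i ≠ 0 := Function.ne_iff.mp hh
    have h1 : 1 ≤ (h i).natAbs := Int.natAbs_pos.mpr hi
    exact h1.trans (Finset.single_le_sum (f := fun j => (h j).natAbs) (fun j _ => Nat.zero_le _)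
      (Finset.mem_univ i))
  have hHpos : (0 : ℝ) < H := by exact_mod_cast hH1
  -- the length of `P` is at most `H ≤ 3H`
  have hlen : (∑ k ∈ Finset.range (P.natDegree + 1), |P.coeff k|) ≤ ((3 * H : ℕ) : ℤ) := by
    calc (∑ k ∈ Finset.range (P.natDegree + 1), |P.coeff k|)
        ≤ ∑ j, |h j| := sum_abs_coeff_sum_monomial_le h _
      _ = (H : ℤ) := hHZ.symm
      _ ≤ ((3 * H : ℕ) : ℤ) := by push_cast; linarith
  -- the Nesterenko–Waldschmidt measure at degree `d` and length `3H`
  have hNW := Literature.NumberTheory.Transcendental.NW1996.transcendence_measure_exp_one P d (3 * H)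
    hP0 hd (KernelTower.natDegree_sum_monomial_le h) hlen (by omega)
  rw [KernelTower.aeval_sum_monomial, ← hc₀] at hNW
  have hlog : Real.log ((3 * H : ℕ) : ℝ) = Real.log 3 + Real.log H := by
    push_cast
    exact Real.log_mul (by norm_num) hHpos.ne'
  rw [hlog] at hNW
  have hsplit : Real.exp (-(c₀ * (Real.log 3 + Real.log H + d))) =
      Real.exp (-(c₀ * (Real.log 3 + d))) * Real.exp (-(c₀ * Real.log H)) := by
    rw [← Real.exp_add]
    congr 1
    ring
  rw [hsplit] at hNW
  -- `H^K · H^{-c₀} ≥ 1`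
  have hHK : (1 : ℝ) ≤ (H : ℝ) ^ K * Real.exp (-(c₀ * Real.log H)) := by
    have hlogH : 0 ≤ Real.log H := Real.log_nonneg (by exact_mod_cast hH1)
    have hpow : (H : ℝ) ^ K = Real.exp (K * Real.log H) := by
      rw [Real.exp_nat_mul, Real.exp_log hHpos]
    rw [hpow, ← Real.exp_add]
    refine Real.one_le_exp ?_
    have hKc : c₀ ≤ K := Nat.le_ceil c₀
    nlinarith [mul_le_mul_of_nonneg_right hKc hlogH]
  -- conclude
  rw [← hHR]
  calc Real.exp (-(c₀ * (Real.log 3 + d)))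
      = Real.exp (-(c₀ * (Real.log 3 + d))) * 1 := (mul_one _).symm
    _ ≤ Real.exp (-(c₀ * (Real.log 3 + d))) * ((H : ℝ) ^ K * Real.exp (-(c₀ * Real.log H))) :=
        mul_le_mul_of_nonneg_left hHK (Real.exp_pos _).le
    _ = (H : ℝ) ^ K * (Real.exp (-(c₀ * (Real.log 3 + d))) * Real.exp (-(c₀ * Real.log H))) := by
        ring
    _ ≤ (H : ℝ) ^ K * ‖∑ i, (h i : ℂ) * Complex.exp 1 ^ (i : ℕ)‖ :=
        mul_le_mul_of_nonneg_left hNW (pow_nonneg hHpos.le _)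

end ExpOnePowersTH

/-! ## The registered stub C12 -/

/-- **Registered stub `stub_expOnePowersTH` of line `sector-split`** (calibration C12, signature
verbatim): the powers `1, e, …, e^{d−1}` of `e = exp 1` satisfy the Technical Hypothesis of
Nesterenko–Philippon, LNM 1752, Ch. 14, Definition 2.6 (`∀ ε > 0 ∃ H₀ ∀ H ≥ H₀ ∀ h ∈ ℤ^d ∖ 0,
|hᵢ| ≤ H ⟹ |∑ hᵢ eⁱ| ≥ exp (−H^ε)`).  Proof: the transcendence measure of `e`
(`ExpOnePowersTH.norm_aeval_exp_one_lowerBound`, Nesterenko–Waldschmidt 1996, Thm 4 (2)) is a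
polynomial lower bound, and a polynomial lower bound implies (T.H.)
(`TechnicalHypothesis.of_lowerBound`); the barrier's `TechnicalHypothesis` is the tree's by
`technicalHypothesis_iff_transcendental`.
[cite: NesterenkoWaldschmidt1996, Thm 4(2)] [cite: NesterenkoPhilippon2001, Ch. 14 Def. 2.6] -/
theorem stub_expOnePowersTH :
    ∀ d : ℕ, Literature.Barriers.Schanuel.TechnicalHypothesis
      (fun i : Fin d => (Complex.exp 1) ^ (i : ℕ)) := by
  intro d
  obtain ⟨c, hc, k, hb⟩ := ExpOnePowersTH.norm_aeval_exp_one_lowerBound d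
  exact (Literature.Barriers.Schanuel.technicalHypothesis_iff_transcendental _).mpr
    (Literature.NumberTheory.Transcendental.TechnicalHypothesis.of_lowerBound hc (k := k) hb)

namespace ExpOnePowersTH

/-! ### The grid `(eⁱ) × (eʲ)` -/

/-- The powers `1, e, …, e^{d−1}` are `ℚ`-linearly independent (`e` is transcendental — Hermite;
tree `transcendental_exp_holds` at `α = 1`). [cite: BakerTNT1975, Ch. 1 Thm 1.2] -/
theorem linearIndependent_exp_one_pow (d : ℕ) :
    LinearIndependent ℚ (fun i : Fin d => (Complex.exp 1) ^ (i : ℕ)) := by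
  rw [Fintype.linearIndependent_iff]
  intro g hg l
  set p : ℚ[X] := ∑ i : Fin d, monomial (i : ℕ) (g i) with hp
  have hpt : aeval (Complex.exp 1) p = 0 := by
    simp only [hp, map_sum, aeval_monomial, ← Algebra.smul_def]
    exact hg
  have hp0 : p = 0 := by
    by_contra hne
    exact Literature.NumberTheory.Transcendental.transcendental_exp_holds isAlgebraic_one one_ne_zero
      ⟨p, hne, hpt⟩
  have hcoeff : p.coeff (l : ℕ) = g l := by
    simp only [hp, finsetSum_coeff, coeff_monomial]
    rw [Finset.sum_eq_single l]
    · simp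
    · intro b _ hb
      rw [if_neg]
      exact fun h => hb (Fin.ext h)
    · intro h; exact absurd (Finset.mem_univ l) h
  rw [← hcoeff, hp0, coeff_zero]

/-- The grid field `gridField₂ x y`, `x = (eⁱ)_{i<d}`, `y = (eʲ)_{j<ℓ}`, is contained in the explicit
field `ℚ(e^{e^k} : k < d + ℓ − 1)` when `d + ℓ < dℓ` (so `d, ℓ ≥ 2`): its generators are the powers
`eⁱ`, `eʲ` of `e = e^{e⁰}` and the `e^{eⁱeʲ} = e^{e^{i+j}}`, `i + j ≤ d + ℓ − 2`. [folklore] -/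
theorem gridField₂_le_explicit {d l : ℕ} (hdl : l + d < d * l) :
    Literature.Barriers.Schanuel.gridField₂
        (fun i : Fin d => (Complex.exp 1) ^ (i : ℕ)) (fun j : Fin l => (Complex.exp 1) ^ (j : ℕ)) ≤
      IntermediateField.adjoin ℚ
        (Set.range (fun k : Fin (d + l - 1) => Complex.exp ((Complex.exp 1) ^ (k : ℕ)))) := by
  obtain ⟨hd1, hl1⟩ := Literature.Barriers.Schanuel.one_le_of_add_lt_mul hdl
  set E := IntermediateField.adjoin ℚ
    (Set.range (fun k : Fin (d + l - 1) => Complex.exp ((Complex.exp 1) ^ (k : ℕ)))) with hE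
  have heE : Complex.exp 1 ∈ E := by
    refine IntermediateField.subset_adjoin _ _ ⟨⟨0, by omega⟩, ?_⟩
    simp
  rw [Literature.Barriers.Schanuel.gridField₂]
  refine IntermediateField.adjoin_le_iff.mpr ?_
  rintro z ((⟨i, rfl⟩ | ⟨j, rfl⟩) | ⟨p, rfl⟩)
  · exact pow_mem heE _
  · exact pow_mem heE _
  · have hlt : (p.1 : ℕ) + (p.2 : ℕ) < d + l - 1 := by
      have h1 := p.1.is_lt; have h2 := p.2.is_lt; omega
    refine IntermediateField.subset_adjoin _ _ ⟨⟨_, hlt⟩, ?_⟩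
    simp [pow_add]

end ExpOnePowersTH

/-! ## The registered stub C13: Diaz's Theorem 2.7 on the `e`-power grid, unconditionally -/

/-- **Registered stub `stub_expOneGridBound` of line `sector-split`** (calibration C13, signature
verbatim) — Diaz's Theorem 2.7, clause `t₂` (Nesterenko–Philippon (eds.), LNM 1752, Ch. 14, Thm 2.7;
Philippon 1986; PROVED in the tree as `Literature.Barriers.Schanuel.ceil_le_trdeg_gridField₂`) made
UNCONDITIONAL on the grid `x = (eⁱ)_{i<d}`, `y = (eʲ)_{j<ℓ}`: for `d + ℓ < dℓ`,
`⌈dℓ/(d+ℓ)⌉ ≤ trdeg_ℚ ℚ(e^{e^k} : k ≤ d + ℓ − 2) = trdeg_ℚ ℚ(e, e^e, e^{e²}, …, e^{e^{d+ℓ−2}})`.  Both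
inputs of Theorem 2.7 are theorems: linear independence of the powers of `e` (Hermite) and (T.H.) for
them (`stub_expOnePowersTH`, Nesterenko–Waldschmidt).  Schanuel's conjecture predicts `d + ℓ − 1`.
[cite: NesterenkoPhilippon2001, Ch. 14 Thm 2.7 (t₂)] [cite: NesterenkoWaldschmidt1996, Thm 4(2)] -/
theorem stub_expOneGridBound :
    ∀ d l : ℕ, l + d < d * l →
      ((⌈((d * l : ℕ) : ℚ) / ((l + d : ℕ) : ℚ)⌉₊ : ℕ) : Cardinal) ≤
        Algebra.trdeg ℚ ↥(IntermediateField.adjoin ℚ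
          (Set.range (fun k : Fin (d + l - 1) => Complex.exp ((Complex.exp 1) ^ (k : ℕ))))) := by
  intro d l h
  exact (Literature.Barriers.Schanuel.ceil_le_trdeg_gridField₂ _ _
    (ExpOnePowersTH.linearIndependent_exp_one_pow d) (stub_expOnePowersTH d)
    (ExpOnePowersTH.linearIndependent_exp_one_pow l) (stub_expOnePowersTH l) h).trans
      (Literature.Barriers.Schanuel.trdeg_mono (ExpOnePowersTH.gridField₂_le_explicit h))

namespace ExpOnePowersTH

/-! ### Instances and the (R)-cells -/

/-- `(d, ℓ) = (4, 5)`: **among `e, e^e, e^{e²}, …, e^{e⁷}` at least three are algebraically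
independent** (`⌈20/9⌉ = 3`).  The value `2` for `e, e^e, e^{e²}, e^{e³}` is already Theorem 2.9 of
loc. cit. (`(d, ℓ) = (2, 3)`, no (T.H.) needed); `3` is the first new value.
[cite: NesterenkoPhilippon2001, Ch. 14 Thm 2.7 (t₂)] -/
theorem three_le_trdeg_exp_pow_eight :
    ((3 : ℕ) : Cardinal) ≤ Algebra.trdeg ℚ ↥(IntermediateField.adjoin ℚ
      (Set.range (fun k : Fin 8 => Complex.exp ((Complex.exp 1) ^ (k : ℕ))))) := by
  have h := stub_expOneGridBound 4 5 (by norm_num)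
  norm_num at h
  exact h

/-- `(d, ℓ) = (6, 7)`: **among `e, e^e, …, e^{e^{11}}` at least four are algebraically independent**
(`⌈42/13⌉ = 4`). [cite: NesterenkoPhilippon2001, Ch. 14 Thm 2.7 (t₂)] -/
theorem four_le_trdeg_exp_pow_twelve :
    ((4 : ℕ) : Cardinal) ≤ Algebra.trdeg ℚ ↥(IntermediateField.adjoin ℚ
      (Set.range (fun k : Fin 12 => Complex.exp ((Complex.exp 1) ^ (k : ℕ))))) := by
  have h := stub_expOneGridBound 6 7 (by norm_num)
  norm_num at h
  exact h

open Summit.Schanuel.Schanuel.Theorems.AclSubsetLogFreeCore.Negative in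
/-- **The `e`-power tuples as (R)-cells.**  `z_N = (1, e, …, e^{N−1})` is a `ℚ`-free tuple of the
log-free core (`e ∈ C_EA`, `DiazAnyBase.exp_one_mem_logFreeCore`; powers by `pow_mem`; freeness by
Hermite), so (R) demands `N ≤ trdeg ℚ(z_N, e^{z_N})`; unconditionally, for `N = d + ℓ − 1` with
`d + ℓ < dℓ`, the grid bound gives `⌈dℓ/(d+ℓ)⌉` on the same field (which contains
`ℚ(e^{e^k} : k < N)`).  Recorded as the conjunction (core membership, freeness, unconditional credit).
[cite: NesterenkoPhilippon2001, Ch. 14 Thm 2.7 (t₂)] -/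
theorem cruxCell_expOnePowers (d l : ℕ) (h : l + d < d * l) :
    (∀ k : Fin (d + l - 1), (Complex.exp 1) ^ (k : ℕ) ∈ logFreeCore) ∧
    LinearIndependent ℚ (fun k : Fin (d + l - 1) => (Complex.exp 1) ^ (k : ℕ)) ∧
    ((⌈((d * l : ℕ) : ℚ) / ((l + d : ℕ) : ℚ)⌉₊ : ℕ) : Cardinal) ≤ Algebra.trdeg ℚ
      ↥(IntermediateField.adjoin ℚ (Set.range (fun k : Fin (d + l - 1) => (Complex.exp 1) ^ (k : ℕ)) ∪
        Set.range (Complex.exp ∘ fun k : Fin (d + l - 1) => (Complex.exp 1) ^ (k : ℕ)))) := by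
  refine ⟨fun _ => pow_mem DiazAnyBase.exp_one_mem_logFreeCore _, linearIndependent_exp_one_pow _,
    (stub_expOneGridBound d l h).trans (Literature.Barriers.Schanuel.trdeg_mono ?_)⟩
  exact IntermediateField.adjoin.mono _ _ _ (by
    rintro _ ⟨k, rfl⟩
    exact Set.mem_union_right _ ⟨k, rfl⟩)

/-- The demand side of the same cells, by the crux's name: (R) ⟹ `N ≤ trdeg ℚ(z_N, e^{z_N})` for
`z_N = (e^k)_{k<N}` (instantiate (R) at the core tuple `z_N`). -/
theorem expOnePowers_demand_of_crux
    (hR : Summit.Schanuel.Schanuel.Theses.RigidCore.SchanuelOnLogFreeCore) (N : ℕ) :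
    (N : Cardinal) ≤ Algebra.trdeg ℚ
      ↥(IntermediateField.adjoin ℚ (Set.range (fun k : Fin N => (Complex.exp 1) ^ (k : ℕ)) ∪
        Set.range (Complex.exp ∘ fun k : Fin N => (Complex.exp 1) ^ (k : ℕ)))) :=
  hR N _ (fun _ => pow_mem DiazAnyBase.exp_one_mem_logFreeCore _) (linearIndependent_exp_one_pow N)

end ExpOnePowersTH

end Summit.Schanuel.Schanuel.Theorems.RigidCore

end
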